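import Mathlib
import HarnessLib
import Summits.HubbardSuperconductivity.HubbardSuperconductivity.Theorems.DeformationLadderLowEnergyRigidityCondensateHeavy
import Summits.HubbardSuperconductivity.HubbardSuperconductivity.Theorems.DeformationLadderLowEnergyRigidityPlateauFourier
import Summits.HubbardSuperconductivity.HubbardSuperconductivity.Theorems.DeformationLadderLowEnergyRigidityCutoffs

/-!
# Route `DeformationLadder` — crux `LowEnergyRigidity` (stmt-HubbardSuperconductivity-1892),
# crux idea `heavy-condensate-fibration`: the compression-gap normal form of the crux

The card's equivalence `compressionGap_iff_rigidity`, BY NAME and unconditional: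
`hcf_compressionGap_iff_lowEnergyRigidity` —
`LowEnergyRigidity ↔ ∃ U > 0, δ ∈ (0,½), a > 0, κ > 0, L₀, ∀ even L ≥ L₀, every unit vector of
S_L ⊓ ⊕_{μ ≤ a} ker(Π_L - μ) has energy ≥ minEnergyOn H_L S_L + κ`,
where `H_L = hubbardTorus 2 L 1 U`, `S_L = szSector N_L 0`, `Π_L = L⁻⁴ Δᴴ Δ` (the Sketch's `condOp`)
and `⊕_{μ ≤ a} ker(Π_L - μ)` is the Sketch's KINEMATIC condensate-poor subspace `condPoor L a`. The
right-hand side is the compression gap stated on vectors (it coincides with the Sketch's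
`CompressionGapAt U δ a κ`, a `minEnergyOn` inequality, whenever `S_L ⊓ condPoor ≠ ⊥`, and is implied
by it always: `hcf_lowEnergyRigidity_of_condPoorGap`).

`→` (`hcf_condPoorGap_of_lowEnergyRigidity`): a unit vector of `condPoor(a/2)` has
`Re⟨Π_L⟩ ≤ a/2 < a` (`hcf_re_expect_le_of_mem_iSup_eigenspace`), so rigidity forbids it below
`E₀ + κ`. `←` (`hcf_lowEnergyRigidity_of_condPoorGap_pointwise`): the smooth cutoff pair
`K₁ = f(Π_L)`, `K₂ = g(Π_L)` of `…PlateauFourier` on `[0,32] ⊇ spec Π_L` (spectral algebra of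
`…Cutoffs`: `K₁² + K₂² = 1`, `K₁ S_L ⊆ condPoor(2a)`, `a K₂² ≤ Π_L`, sector invariance), IMS budget
`(C_f² + C_g²)‖[Π_L,[Π_L,H_L]]‖ = O(L⁻²)` (`…SpectralTransfer` + `…CondensateHeavy`), and the
fibration principle (`…Fibration`).
-/

namespace Summit.HubbardSuperconductivity.HubbardSuperconductivity.Theorems

set_option linter.dupNamespace false

open Literature.MathematicalPhysics.QuantumLattice Literature.Probability.LatticeModels Matrix Complex
open scoped Matrix.Norms.L2Operator ComplexOrder
open Summit.HubbardSuperconductivity.HubbardSuperconductivity.Theses.DeformationLadder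

/-- **`LowEnergyRigidity` from a compression gap, gap stated on vectors** (variant of
`hcf_lowEnergyRigidity_of_compressionGap` whose gap hypothesis is
`∀ χ ∈ S_L ⊓ T_L, (E₀ + κ)‖χ‖² ≤ Re⟨χ, H_L χ⟩` instead of a `minEnergyOn` inequality, so that an
empty `S_L ⊓ T_L` is harmless). [folklore] -/
theorem hcf_lowEnergyRigidity_of_compressionGap_pointwise {U : ℝ} (hU : 0 < U) {δ : ℝ}
    (hδ : δ ∈ Set.Ioo (0 : ℝ) (1 / 2)) {κ a₀ : ℝ} (hκ : 0 < κ) (ha₀ : 0 < a₀) (L₀ : ℕ)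
    (h : ∀ (L : ℕ) [NeZero L], L₀ ≤ L → Even L →
      ∃ (T : Submodule ℂ (Fock (Orb (FermionTorus 2 L))))
        (K₁ K₂ : Matrix (Finset (Orb (FermionTorus 2 L))) (Finset (Orb (FermionTorus 2 L))) ℂ),
        (∀ χ ∈ szSector (2 * ⌊(1 - δ) * (L : ℝ) ^ 2 / 2⌋₊) 0, χ ∈ T →
            ((hubbardTorus 2 L 1 U).minEnergyOn (szSector (2 * ⌊(1 - δ) * (L : ℝ) ^ 2 / 2⌋₊) 0) + κ) *
                (star χ ⬝ᵥ χ).re ≤ (star χ ⬝ᵥ (hubbardTorus 2 L 1 U *ᵥ χ)).re) ∧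
          K₁ᴴ = K₁ ∧ K₂ᴴ = K₂ ∧ K₁ * K₁ + K₂ * K₂ = 1 ∧
          (∀ ψ ∈ szSector (2 * ⌊(1 - δ) * (L : ℝ) ^ 2 / 2⌋₊) 0,
              K₁ *ᵥ ψ ∈ szSector (2 * ⌊(1 - δ) * (L : ℝ) ^ 2 / 2⌋₊) 0) ∧
          (∀ ψ ∈ szSector (2 * ⌊(1 - δ) * (L : ℝ) ^ 2 / 2⌋₊) 0,
              K₂ *ᵥ ψ ∈ szSector (2 * ⌊(1 - δ) * (L : ℝ) ^ 2 / 2⌋₊) 0) ∧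
          (∀ ψ ∈ szSector (2 * ⌊(1 - δ) * (L : ℝ) ^ 2 / 2⌋₊) 0, K₁ *ᵥ ψ ∈ T) ∧
          (∀ ψ ∈ szSector (2 * ⌊(1 - δ) * (L : ℝ) ^ 2 / 2⌋₊) 0,
              a₀ * (star (K₂ *ᵥ ψ) ⬝ᵥ (K₂ *ᵥ ψ)).re ≤
                (star ψ ⬝ᵥ ((((1 : ℂ) / ((L : ℂ) ^ 4)) •
                  ((pairField dWaveFormFactor L)ᴴ * pairField dWaveFormFactor L)) *ᵥ ψ)).re) ∧
          (∀ ψ ∈ szSector (2 * ⌊(1 - δ) * (L : ℝ) ^ 2 / 2⌋₊) 0,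
              |(star ψ ⬝ᵥ (((K₁ * (K₁ * hubbardTorus 2 L 1 U - hubbardTorus 2 L 1 U * K₁) -
                    (K₁ * hubbardTorus 2 L 1 U - hubbardTorus 2 L 1 U * K₁) * K₁) +
                  (K₂ * (K₂ * hubbardTorus 2 L 1 U - hubbardTorus 2 L 1 U * K₂) -
                    (K₂ * hubbardTorus 2 L 1 U - hubbardTorus 2 L 1 U * K₂) * K₂)) *ᵥ ψ)).re| ≤
                2 * (κ / 4) * (star ψ ⬝ᵥ ψ).re)) :
    LowEnergyRigidity := by
  refine ⟨U, hU, δ, hδ, κ / 4, by positivity, a₀ / 2, by positivity, L₀, ?_⟩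
  intro L _ hL hev φ hφS hφ1 hlow
  obtain ⟨T, K₁, K₂, hgap, hK₁, hK₂, hKK, hS₁, hS₂, hT, hP, hDC⟩ := h L hL hev
  set N : ℕ := 2 * ⌊(1 - δ) * (L : ℝ) ^ 2 / 2⌋₊ with hN
  set Hm := hubbardTorus 2 L 1 U with hHm
  set S : Submodule ℂ (Fock (Orb (FermionTorus 2 L))) := szSector N 0 with hS_def
  set P := ((1 : ℂ) / ((L : ℂ) ^ 4)) • ((pairField dWaveFormFactor L)ᴴ * pairField dWaveFormFactor L)
    with hP_def
  set E₀ := Hm.minEnergyOn S with hE₀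
  have hE₀le : ∀ ψ ∈ S, E₀ * (star ψ ⬝ᵥ ψ).re ≤ (star ψ ⬝ᵥ (Hm *ᵥ ψ)).re := fun ψ hψ =>
    hcf_minEnergyOn_mul_le Hm S hψ
  have key := hcf_fibration_rigidity Hm P K₁ K₂ hK₁ hK₂ hKK S T hS₁ hS₂ hT (κ' := κ / 4) hκ ha₀
    hE₀le hgap hP hDC φ hφS hφ1 hlow
  have hPexp : (star φ ⬝ᵥ (P *ᵥ φ)).re =
      (expect ((pairField dWaveFormFactor L)ᴴ * pairField dWaveFormFactor L) φ).re / (L : ℝ) ^ 4 := by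
    have hc : (1 : ℂ) / ((L : ℂ) ^ 4) = ((1 / (L : ℝ) ^ 4 : ℝ) : ℂ) := by push_cast; ring
    simp only [hP_def, expect]
    rw [hc, smul_mulVec, dotProduct_smul, smul_eq_mul, Complex.re_ofReal_mul]
    ring
  rw [hPexp] at key
  have hk : a₀ * (κ - κ / 4 - κ / 4) / κ = a₀ / 2 := by
    field_simp
    ring
  rw [hk] at key
  exact key

/-- The condensate operator `Π_L = L⁻⁴ Δᴴ Δ` is positive semidefinite with `‖Π_L‖ ≤ 32`
(`‖Δ_d‖ ≤ 4√2 L²`). [folklore] -/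
theorem hcf_condOp_posSemidef_norm_le (L : ℕ) [NeZero L] :
    (((1 : ℂ) / ((L : ℂ) ^ 4)) • ((pairField dWaveFormFactor L)ᴴ * pairField dWaveFormFactor L)).PosSemidef ∧
      ‖((1 : ℂ) / ((L : ℂ) ^ 4)) • ((pairField dWaveFormFactor L)ᴴ * pairField dWaveFormFactor L)‖ ≤ 32 := by
  have hL : (0 : ℝ) < (L : ℝ) := Nat.cast_pos.2 (Nat.pos_of_ne_zero (NeZero.ne L))
  have hc : (1 : ℂ) / ((L : ℂ) ^ 4) = ((1 / (L : ℝ) ^ 4 : ℝ) : ℂ) := by push_cast; ring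
  constructor
  · rw [hc]
    exact (posSemidef_conjTranspose_mul_self _).smul (by positivity)
  · rw [norm_smul, l2_opNorm_conjTranspose_mul_self, hc, Complex.norm_real, Real.norm_eq_abs,
      abs_of_pos (by positivity)]
    have h := norm_pairField_dWave_le L
    have h0 : 0 ≤ ‖pairField dWaveFormFactor L‖ := norm_nonneg _
    have hs : Real.sqrt 2 ^ 2 = 2 := Real.sq_sqrt (by norm_num)
    calc 1 / (L : ℝ) ^ 4 * (‖pairField dWaveFormFactor L‖ * ‖pairField dWaveFormFactor L‖)
        ≤ 1 / (L : ℝ) ^ 4 * ((4 * Real.sqrt 2 * (L : ℝ) ^ 2) * (4 * Real.sqrt 2 * (L : ℝ) ^ 2)) := by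
          gcongr
      _ = 32 := by
          field_simp
          nlinarith [hs]

/-- **`LowEnergyRigidity` from a condensate-poor compression gap, gap stated on vectors** (crux idea
`heavy-condensate-fibration`, the card's `compressionGap_iff_rigidity`, direction `→`, BY NAME). If
for some `U > 0`, `δ ∈ (0,½)`, `a > 0`, `κ > 0` and all large even `L`, every vector `χ` of the
sector `S_L = szSector N_L 0` lying in the KINEMATIC condensate-poor subspace
`⊕_{μ ≤ 2a} ker(Π_L - μ)` (`Π_L = L⁻⁴ Δᴴ Δ`) has `(minEnergyOn H_L S_L + κ)‖χ‖² ≤ Re⟨χ, H_L χ⟩`,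
then `LowEnergyRigidity` holds with `(κ', a') = (κ/4, a/2)`. Proof: plateau pair `f² + g² = 1` on
`[0,32] ⊇ spec Π_L`, `Kᵢ = f(Π_L), g(Π_L)`; `K₁ S_L ⊆ ⊕_{μ≤2a}` (`f = 0` above `2a`), `a K₂² ≤ Π_L`,
sector invariance (`Kᵢ` are polynomials in `Π_L`), IMS budget
`(C_f² + C_g²)‖[Π_L,[Π_L,H_L]]‖ ≤ C(1+|U|)/L² ≤ κ/2`, and `hcf_lowEnergyRigidity_of_compressionGap_pointwise`.
[folklore] -/
theorem hcf_lowEnergyRigidity_of_condPoorGap_pointwise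
    (h : ∃ U : ℝ, 0 < U ∧ ∃ δ ∈ Set.Ioo (0 : ℝ) (1 / 2), ∃ a : ℝ, 0 < a ∧ ∃ κ : ℝ, 0 < κ ∧ ∃ L₀ : ℕ,
      ∀ (L : ℕ) [NeZero L], L₀ ≤ L → Even L →
        ∀ χ ∈ szSector (2 * ⌊(1 - δ) * (L : ℝ) ^ 2 / 2⌋₊) 0,
          χ ∈ (⨆ (μ : ℝ) (_ : μ ≤ 2 * a), Module.End.eigenspace
              (Matrix.toLin' (((1 : ℂ) / ((L : ℂ) ^ 4)) •
                ((pairField dWaveFormFactor L)ᴴ * pairField dWaveFormFactor L))) (μ : ℂ)) →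
            ((hubbardTorus 2 L 1 U).minEnergyOn (szSector (2 * ⌊(1 - δ) * (L : ℝ) ^ 2 / 2⌋₊) 0) + κ) *
                (star χ ⬝ᵥ χ).re ≤ (star χ ⬝ᵥ (hubbardTorus 2 L 1 U *ᵥ χ)).re) :
    LowEnergyRigidity := by
  obtain ⟨U, hU, δ, hδ, a, ha, κ, hκ, L₀, hgap⟩ := h
  -- the plateau pair on the spectral window `[0, 32]`
  obtain ⟨f, g, cf, cg, ω, hfg, hfz, hag, hcfs, hcgs, hfser, hgser⟩ :=
    hcf_plateau_cutoff_functions ha (by norm_num : (0 : ℝ) < 32)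
  set Cf : ℝ := |ω| * ∑' k, ‖cf k‖ * |(k : ℝ)| with hCf
  set Cg : ℝ := |ω| * ∑' k, ‖cg k‖ * |(k : ℝ)| with hCg
  -- the heavy-variable constant at `t = 1`, `μ = 0`
  set s : ℝ := ((insert (0 : Site 2) unitSteps).card : ℝ) with hs_def
  set K : ℝ := 2 * ∑ e ∈ insert (0 : Site 2) unitSteps, |dWaveFormFactor e / Real.sqrt 2| with hK_def
  set C₁ : ℝ := (9000 + 144 * s ^ 2 * (s + 2)) * K ^ 4 * (2 * |(1 : ℝ)| + |U| + 2 * |(0 : ℝ)|) with hC₁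
  have hC₁0 : 0 ≤ C₁ := by positivity
  set Ctot : ℝ := (Cf ^ 2 + Cg ^ 2) * C₁ with hCtot
  have hCtot0 : 0 ≤ Ctot := by positivity
  set L₁ : ℕ := ⌈2 * Ctot / κ⌉₊ + 1 with hL₁
  refine hcf_lowEnergyRigidity_of_compressionGap_pointwise hU hδ hκ ha (max L₀ L₁) fun L _ hL hev => ?_
  have hL0 : L₀ ≤ L := le_of_max_le_left hL
  have hL1 : L₁ ≤ L := le_of_max_le_right hL
  have hLpos : (0 : ℝ) < (L : ℝ) := Nat.cast_pos.2 (Nat.pos_of_ne_zero (NeZero.ne L))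
  have hLκ : 2 * Ctot / κ ≤ (L : ℝ) ^ 2 := by
    have h1 : 2 * Ctot / κ ≤ (L₁ : ℝ) := by
      rw [hL₁]
      push_cast
      linarith [Nat.le_ceil (2 * Ctot / κ)]
    have h2 : (L₁ : ℝ) ≤ (L : ℝ) := by exact_mod_cast hL1
    have hLge1 : (1 : ℝ) ≤ (L : ℝ) := by exact_mod_cast Nat.pos_of_ne_zero (NeZero.ne L)
    nlinarith
  -- the objects
  set N : ℕ := 2 * ⌊(1 - δ) * (L : ℝ) ^ 2 / 2⌋₊ with hN
  set Hm := hubbardTorus 2 L 1 U with hHm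
  set S : Submodule ℂ (Fock (Orb (FermionTorus 2 L))) := szSector N 0 with hS_def
  set P : Matrix (Finset (Orb (FermionTorus 2 L))) (Finset (Orb (FermionTorus 2 L))) ℂ :=
    ((1 : ℂ) / ((L : ℂ) ^ 4)) • ((pairField dWaveFormFactor L)ᴴ * pairField dWaveFormFactor L)
    with hP_def
  obtain ⟨hPpsd, hPnorm⟩ := hcf_condOp_posSemidef_norm_le L
  have hP : P.IsHermitian := hPpsd.1
  have hspec : ∀ i, hP.eigenvalues i ∈ Set.Icc (0 : ℝ) 32 := fun i =>
    ⟨hPpsd.eigenvalues_nonneg i, (hcf_eigenvalues_le_norm hP i).trans hPnorm⟩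
  -- the cutoff pair
  set K₁ := hP.cfc f with hK₁
  set K₂ := hP.cfc g with hK₂
  set T : Submodule ℂ (Fock (Orb (FermionTorus 2 L))) :=
    ⨆ (μ : ℝ) (_ : μ ≤ 2 * a), Module.End.eigenspace (Matrix.toLin' P) (μ : ℂ) with hT_def
  have hSinv : ∀ v ∈ S, P *ᵥ v ∈ S := by
    intro v hv
    simp only [hS_def, hN] at hv ⊢
    rw [mem_szSector_two_mul_zero_iff] at hv ⊢
    exact ((DeformationLadder.preservesSectors_pairPenalty L).smul _).isInSector_mulVec hv
  refine ⟨T, K₁, K₂, fun χ hχS hχT => hgap L hL0 hev χ hχS hχT, hcf_cfc_conjTranspose hP f,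
    hcf_cfc_conjTranspose hP g, ?_, hcf_cfc_mulVec_mem hP S hSinv f, hcf_cfc_mulVec_mem hP S hSinv g,
    ?_, ?_, ?_⟩
  · -- `K₁² + K₂² = 1`
    rw [hK₁, hK₂, hcf_cfc_mul, hcf_cfc_mul, hcf_cfc_add]
    exact hcf_cfc_eq_one hP fun i => by
      have := hfg (hP.eigenvalues i) (hspec i)
      nlinarith [this]
  · -- `K₁ S ⊆ T`
    intro ψ _
    exact hcf_cfc_mulVec_mem_iSup_eigenspace hP f (2 * a)
      (fun i hi => hfz (hP.eigenvalues i) (hspec i) hi.le) ψ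
  · -- Markov domination `a ‖K₂ψ‖² ≤ Re⟨ψ, Π_L ψ⟩`
    intro ψ _
    exact hcf_cfc_sq_form_le hP g a (fun i => hag (hP.eigenvalues i) (hspec i)) ψ
  · -- the IMS budget
    intro ψ _
    have hf' : ∀ i, HasSum (fun k => cf k * Complex.exp (Complex.I * ((k : ℝ) * ω * hP.eigenvalues i)))
        ((f (hP.eigenvalues i) : ℝ) : ℂ) := fun i => hfser (hP.eigenvalues i) (hspec i)
    have hg' : ∀ i, HasSum (fun k => cg k * Complex.exp (Complex.I * ((k : ℝ) * ω * hP.eigenvalues i)))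
        ((g (hP.eigenvalues i) : ℝ) : ℂ) := fun i => hgser (hP.eigenvalues i) (hspec i)
    have h1 := hcf_norm_doubleCommutator_cfc_le hP f cf ω hcfs hf' Hm
    have h2 := hcf_norm_doubleCommutator_cfc_le hP g cg ω hcgs hg' Hm
    have hheavy : ‖P * (P * Hm - Hm * P) - (P * Hm - Hm * P) * P‖ ≤ C₁ / (L : ℝ) ^ 2 := by
      have h := hcf_norm_condensate_doubleCommutator_le dWaveFormFactor L 1 U 0
      rw [hubbardTorusWith_zero] at h
      exact h
    have hDC : ‖(K₁ * (K₁ * Hm - Hm * K₁) - (K₁ * Hm - Hm * K₁) * K₁) +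
        (K₂ * (K₂ * Hm - Hm * K₂) - (K₂ * Hm - Hm * K₂) * K₂)‖ ≤ Ctot / (L : ℝ) ^ 2 := by
      refine (norm_add_le _ _).trans ?_
      calc ‖K₁ * (K₁ * Hm - Hm * K₁) - (K₁ * Hm - Hm * K₁) * K₁‖ +
            ‖K₂ * (K₂ * Hm - Hm * K₂) - (K₂ * Hm - Hm * K₂) * K₂‖
          ≤ Cf ^ 2 * ‖P * (P * Hm - Hm * P) - (P * Hm - Hm * P) * P‖ +
            Cg ^ 2 * ‖P * (P * Hm - Hm * P) - (P * Hm - Hm * P) * P‖ := add_le_add h1 h2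
        _ ≤ Cf ^ 2 * (C₁ / (L : ℝ) ^ 2) + Cg ^ 2 * (C₁ / (L : ℝ) ^ 2) := by gcongr
        _ = Ctot / (L : ℝ) ^ 2 := by rw [hCtot]; ring
    have hray := abs_re_star_dotProduct_mulVec_le
      ((K₁ * (K₁ * Hm - Hm * K₁) - (K₁ * Hm - Hm * K₁) * K₁) +
        (K₂ * (K₂ * Hm - Hm * K₂) - (K₂ * Hm - Hm * K₂) * K₂)) ψ
    have hψ : 0 ≤ (star ψ ⬝ᵥ ψ).re := (Complex.nonneg_iff.1 (dotProduct_star_self_nonneg ψ)).1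
    have hsmall : Ctot / (L : ℝ) ^ 2 ≤ 2 * (κ / 4) := by
      rw [div_le_iff₀ (by positivity)]
      have : 2 * Ctot ≤ κ * (L : ℝ) ^ 2 := by
        have h := (div_le_iff₀ hκ).1 hLκ
        linarith
      linarith
    exact hray.trans ((mul_le_mul_of_nonneg_right (hDC.trans hsmall) hψ))

/-- **`LowEnergyRigidity` from the Sketch's `CompressionGapAt U δ (2a) κ`** (the `minEnergyOn` form
of the compression gap on `S_L ⊓ condPoor L (2a)`): it implies the vector form, hence the crux.
[folklore] -/
theorem hcf_lowEnergyRigidity_of_condPoorGap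
    (h : ∃ U : ℝ, 0 < U ∧ ∃ δ ∈ Set.Ioo (0 : ℝ) (1 / 2), ∃ a : ℝ, 0 < a ∧ ∃ κ : ℝ, 0 < κ ∧ ∃ L₀ : ℕ,
      ∀ (L : ℕ) [NeZero L], L₀ ≤ L → Even L →
        (hubbardTorus 2 L 1 U).minEnergyOn (szSector (2 * ⌊(1 - δ) * (L : ℝ) ^ 2 / 2⌋₊) 0) + κ ≤
          (hubbardTorus 2 L 1 U).minEnergyOn (szSector (2 * ⌊(1 - δ) * (L : ℝ) ^ 2 / 2⌋₊) 0 ⊓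
            ⨆ (μ : ℝ) (_ : μ ≤ 2 * a), Module.End.eigenspace
              (Matrix.toLin' (((1 : ℂ) / ((L : ℂ) ^ 4)) •
                ((pairField dWaveFormFactor L)ᴴ * pairField dWaveFormFactor L))) (μ : ℂ))) :
    LowEnergyRigidity := by
  obtain ⟨U, hU, δ, hδ, a, ha, κ, hκ, L₀, hgap⟩ := h
  refine hcf_lowEnergyRigidity_of_condPoorGap_pointwise ⟨U, hU, δ, hδ, a, ha, κ, hκ, L₀, ?_⟩
  intro L _ hL hev χ hχS hχT
  have h1 := hcf_minEnergyOn_mul_le (hubbardTorus 2 L 1 U) _ (Submodule.mem_inf.2 ⟨hχS, hχT⟩)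
  have hnn : 0 ≤ (star χ ⬝ᵥ χ).re := (Complex.nonneg_iff.1 (dotProduct_star_self_nonneg _)).1
  exact (mul_le_mul_of_nonneg_right (hgap L hL hev) hnn).trans h1

/-- **`LowEnergyRigidity` ⇒ the condensate-poor compression gap** (the card's
`compressionGap_iff_rigidity`, direction `←`, and its kernel-gap item 5(i)): at the crux's
`(U, δ, κ, a)`, for all large even `L`, every vector `χ` of `S_L ⊓ ⊕_{μ ≤ a/2} ker(Π_L - μ)` has
`(minEnergyOn H_L S_L + κ)‖χ‖² ≤ Re⟨χ, H_L χ⟩` — a unit vector there has LRO density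
`Re⟨χ, Π_L χ⟩ ≤ a/2 < a` (`hcf_re_expect_le_of_mem_iSup_eigenspace`), so rigidity puts it above
`E₀ + κ`. [folklore] -/
theorem hcf_condPoorGap_of_lowEnergyRigidity (h : LowEnergyRigidity) :
    ∃ U : ℝ, 0 < U ∧ ∃ δ ∈ Set.Ioo (0 : ℝ) (1 / 2), ∃ a : ℝ, 0 < a ∧ ∃ κ : ℝ, 0 < κ ∧ ∃ L₀ : ℕ,
      ∀ (L : ℕ) [NeZero L], L₀ ≤ L → Even L →
        ∀ χ ∈ szSector (2 * ⌊(1 - δ) * (L : ℝ) ^ 2 / 2⌋₊) 0,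
          χ ∈ (⨆ (μ : ℝ) (_ : μ ≤ a), Module.End.eigenspace
              (Matrix.toLin' (((1 : ℂ) / ((L : ℂ) ^ 4)) •
                ((pairField dWaveFormFactor L)ᴴ * pairField dWaveFormFactor L))) (μ : ℂ)) →
            ((hubbardTorus 2 L 1 U).minEnergyOn (szSector (2 * ⌊(1 - δ) * (L : ℝ) ^ 2 / 2⌋₊) 0) + κ) *
                (star χ ⬝ᵥ χ).re ≤ (star χ ⬝ᵥ (hubbardTorus 2 L 1 U *ᵥ χ)).re := by
  obtain ⟨U, hU, δ, hδ, κ, hκ, a, ha, L₀, hL⟩ := h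
  refine ⟨U, hU, δ, hδ, a / 2, by positivity, κ, hκ, L₀, fun L _ hL0 hev χ hχS hχT => ?_⟩
  set P := ((1 : ℂ) / ((L : ℂ) ^ 4)) • ((pairField dWaveFormFactor L)ᴴ * pairField dWaveFormFactor L)
    with hP_def
  have hP : P.IsHermitian := (hcf_condOp_posSemidef_norm_le L).1.1
  by_cases hχ0 : χ = 0
  · subst hχ0
    simp
  -- normalise `χ`
  obtain ⟨c, hc, hc1⟩ := Literature.MathematicalPhysics.QuantumLattice.exists_smul_unit hχ0
  set φ := c • χ with hφ
  have hφS : φ ∈ szSector (2 * ⌊(1 - δ) * (L : ℝ) ^ 2 / 2⌋₊) 0 := Submodule.smul_mem _ c hχS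
  have hφT : φ ∈ ⨆ (μ : ℝ) (_ : μ ≤ a / 2), Module.End.eigenspace (Matrix.toLin' P) (μ : ℂ) :=
    Submodule.smul_mem _ c hχT
  -- its LRO density is `≤ a/2 < a`
  have hlro : (expect ((pairField dWaveFormFactor L)ᴴ * pairField dWaveFormFactor L) φ).re / (L : ℝ) ^ 4
      < a := by
    have h1 := hcf_re_expect_le_of_mem_iSup_eigenspace hP (a / 2) hφT
    rw [hc1, Complex.one_re, mul_one] at h1
    have hPexp : (star φ ⬝ᵥ (P *ᵥ φ)).re =
        (expect ((pairField dWaveFormFactor L)ᴴ * pairField dWaveFormFactor L) φ).re / (L : ℝ) ^ 4 := by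
      have hc' : (1 : ℂ) / ((L : ℂ) ^ 4) = ((1 / (L : ℝ) ^ 4 : ℝ) : ℂ) := by push_cast; ring
      simp only [hP_def, expect]
      rw [hc', smul_mulVec, dotProduct_smul, smul_eq_mul, Complex.re_ofReal_mul]
      ring
    rw [← hPexp]
    linarith
  -- hence `φ` is NOT a low-energy state: `Re⟨φ, Hφ⟩ > E₀ + κ`
  have hhigh : (hubbardTorus 2 L 1 U).minEnergyOn (szSector (2 * ⌊(1 - δ) * (L : ℝ) ^ 2 / 2⌋₊) 0) + κ <
      (star φ ⬝ᵥ (hubbardTorus 2 L 1 U *ᵥ φ)).re := by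
    by_contra hle
    exact absurd (hL L hL0 hev φ hφS hc1 (not_lt.1 hle)) (not_le.2 hlro)
  -- undo the normalisation
  have hcc : (0 : ℝ) < (starRingEnd ℂ c * c).re := by
    rw [Complex.conj_mul', ← Complex.ofReal_pow, Complex.ofReal_re]
    exact pow_pos (norm_pos_iff.2 hc) 2
  have hr_im : (starRingEnd ℂ c * c).im = 0 := by
    rw [Complex.conj_mul', ← Complex.ofReal_pow, Complex.ofReal_im]
  have hnorm : (star φ ⬝ᵥ φ) = (starRingEnd ℂ c * c) * (star χ ⬝ᵥ χ) := by
    rw [hφ, star_smul, smul_dotProduct, dotProduct_smul, smul_smul, smul_eq_mul, Complex.star_def]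
  have hray : star φ ⬝ᵥ (hubbardTorus 2 L 1 U *ᵥ φ) =
      (starRingEnd ℂ c * c) * (star χ ⬝ᵥ (hubbardTorus 2 L 1 U *ᵥ χ)) := by
    rw [hφ, mulVec_smul, star_smul, smul_dotProduct, dotProduct_smul, smul_smul, smul_eq_mul,
      Complex.star_def]
  have h1 : (starRingEnd ℂ c * c).re * (star χ ⬝ᵥ χ).re = 1 := by
    have := congrArg Complex.re hnorm
    rw [hc1, Complex.one_re, Complex.mul_re, hr_im, zero_mul, sub_zero] at this
    exact this.symm
  have h2 : (star φ ⬝ᵥ (hubbardTorus 2 L 1 U *ᵥ φ)).re =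
      (starRingEnd ℂ c * c).re * (star χ ⬝ᵥ (hubbardTorus 2 L 1 U *ᵥ χ)).re := by
    rw [hray, Complex.mul_re, hr_im, zero_mul, sub_zero]
  rw [h2] at hhigh
  -- multiply through by `‖χ‖² = 1 / r`
  have hχpos : 0 < (star χ ⬝ᵥ χ).re :=
    (Complex.pos_iff.1 (dotProduct_star_self_pos_iff.2 hχ0)).1
  have key : ((hubbardTorus 2 L 1 U).minEnergyOn (szSector (2 * ⌊(1 - δ) * (L : ℝ) ^ 2 / 2⌋₊) 0) + κ) *
      (star χ ⬝ᵥ χ).re < (starRingEnd ℂ c * c).re * (star χ ⬝ᵥ (hubbardTorus 2 L 1 U *ᵥ χ)).re *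
        (star χ ⬝ᵥ χ).re := mul_lt_mul_of_pos_right hhigh hχpos
  have hrw : (starRingEnd ℂ c * c).re * (star χ ⬝ᵥ (hubbardTorus 2 L 1 U *ᵥ χ)).re *
      (star χ ⬝ᵥ χ).re = (star χ ⬝ᵥ (hubbardTorus 2 L 1 U *ᵥ χ)).re := by
    calc (starRingEnd ℂ c * c).re * (star χ ⬝ᵥ (hubbardTorus 2 L 1 U *ᵥ χ)).re * (star χ ⬝ᵥ χ).re
        = ((starRingEnd ℂ c * c).re * (star χ ⬝ᵥ χ).re) *
            (star χ ⬝ᵥ (hubbardTorus 2 L 1 U *ᵥ χ)).re := by ring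
      _ = _ := by rw [h1, one_mul]
  rw [hrw] at key
  exact key.le

/-- **The compression-gap normal form of the crux** (crux idea `heavy-condensate-fibration`, the
card's `compressionGap_iff_rigidity`, BY NAME and unconditional): `LowEnergyRigidity` holds iff, for
some `U > 0`, `δ ∈ (0,½)`, `a > 0`, `κ > 0` and all large even `L`, the Hubbard Hamiltonian
`H_L = hubbardTorus 2 L 1 U` is gapped by `κ` above its `(N_L, S^z=0)`-sector ground energy on the
KINEMATIC (U-independent) condensate-poor part `⊕_{μ ≤ a} ker(Π_L - μ)` of the sector
(`Π_L = L⁻⁴ Δᴴ Δ`, `Δ = pairField dWaveFormFactor L`): every vector `χ` of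
`S_L ⊓ ⊕_{μ ≤ a} ker(Π_L - μ)` has `(minEnergyOn H_L S_L + κ)‖χ‖² ≤ Re⟨χ, H_L χ⟩` — the crux IS a
statement about ONE ground energy of ONE compression to a fixed subspace. (`→`:
`hcf_condPoorGap_of_lowEnergyRigidity`; `←`: `hcf_lowEnergyRigidity_of_condPoorGap_pointwise` with
`a ↦ a/2`.) [folklore] -/
theorem hcf_compressionGap_iff_lowEnergyRigidity :
    LowEnergyRigidity ↔
      ∃ U : ℝ, 0 < U ∧ ∃ δ ∈ Set.Ioo (0 : ℝ) (1 / 2), ∃ a : ℝ, 0 < a ∧ ∃ κ : ℝ, 0 < κ ∧ ∃ L₀ : ℕ,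
        ∀ (L : ℕ) [NeZero L], L₀ ≤ L → Even L →
          ∀ χ ∈ szSector (2 * ⌊(1 - δ) * (L : ℝ) ^ 2 / 2⌋₊) 0,
            χ ∈ (⨆ (μ : ℝ) (_ : μ ≤ a), Module.End.eigenspace
                (Matrix.toLin' (((1 : ℂ) / ((L : ℂ) ^ 4)) •
                  ((pairField dWaveFormFactor L)ᴴ * pairField dWaveFormFactor L))) (μ : ℂ)) →
              ((hubbardTorus 2 L 1 U).minEnergyOn (szSector (2 * ⌊(1 - δ) * (L : ℝ) ^ 2 / 2⌋₊) 0) + κ) *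
                  (star χ ⬝ᵥ χ).re ≤ (star χ ⬝ᵥ (hubbardTorus 2 L 1 U *ᵥ χ)).re := by
  constructor
  · exact hcf_condPoorGap_of_lowEnergyRigidity
  · rintro ⟨U, hU, δ, hδ, a, ha, κ, hκ, L₀, h⟩
    refine hcf_lowEnergyRigidity_of_condPoorGap_pointwise ⟨U, hU, δ, hδ, a / 2, by positivity, κ, hκ, L₀, ?_⟩
    intro L _ hL hev χ hχS hχT
    have ha2 : 2 * (a / 2) = a := by ring
    rw [ha2] at hχT
    exact h L hL hev χ hχS hχT

end Summit.HubbardSuperconductivity.HubbardSuperconductivity.Theorems
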